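import Summits.BirchSwinnertonDyer.BirchSwinnertonDyer.Theorems.RamifiedSevenEllipticUnitsBottomSaturationUncond
import Summits.BirchSwinnertonDyer.BirchSwinnertonDyer.Theorems.RamifiedSevenEllipticUnitsEllipticUnitValueSevenOfGZKStubBottomLocalIndexSplitSevenZp
import Summits.BirchSwinnertonDyer.BirchSwinnertonDyer.Theorems.RamifiedSevenEllipticUnitsEllipticUnitValueSevenOfGZKStubLocalMordellWeilDictSevenZp
import Summits.BirchSwinnertonDyer.Rank1Residual.X12.O11.RamifiedRelativeValuationLineZp
import HarnessLib

set_option linter.dupNamespace false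
set_option autoImplicit false

/-!
# K7r crux `EllipticUnitValueSevenOfGZK` (stmt-BirchSwinnertonDyer-19945), line `rubin-formula-zp`:
# the open stub S_open IS the crux — `RamifiedCMRubinFormulaAtZp ↔ RamifiedCMBottomClassIndexLawAtZp`
# modulo S_dict′, S_sat-Zp, S_B4′, hence, with the three landed stubs, `(GZK → S_open on 𝒞₇) ↔ crux`
# (cell `bsd-cm`, seat `bsd-cm-k7r-c4` g6; `--supports` 19945; the `…Zp` analogue of ram g8's p465172)

HONEST FRAMING. Nothing is asserted about any curve; BSD is not claimed; the crux stays OPEN. This file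
records, in the kernel, what the reshaped line `rubin-formula-zp` IS: over the corrected carrier and with
the three dictionary stubs in hand (S_dict′ p474339, S_B4′ p474196, S_sat-Zp — the unconditional closer
`stub_bottomSaturationSevenZpOfGZK` / `BottomSaturationUncond.ramifiedCMBottomSaturationAtZp_holds`, k7r-c2 g5 p479978 over
this seat's p478864/p479450), the research stub S_open (`X12.O11.RamifiedCMRubinFormulaAtZp W 7`, the
route's tribunal-fit witness `stub_rubinFormulaSevenZp`) is EQUIVALENT to the crux body
`X12.O11.RamifiedCMBottomClassIndexLawAtZp W 7` — the line RESTATES the value law in the local exponent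
`λ₀`, it does not weaken it (witness-of-weakness bookkeeping for J/T1; cf. MEMO-k7r-c4-g6-CONTINUATION §3.4:
with the reciprocity field `erl` vacuous at weight one, no datum-level analytic handle on S_open exists yet).

* `ramifiedCMRubinFormulaAtZp_of_indexLawAtZp` — (R-PR)|IMC-Zp ∧ S_dict′ ∧ S_sat-Zp ∧ S_B4′ ⟹ S_open
  (uniqueness of `λ₀`, `EllipticUnitClassData.hasLocalBottomIndexExpZp_unique`; linear arithmetic).
* `ramifiedCMRubinFormulaAtZp_iff_indexLawAtZp` — with the PROVED composition (p474028) the converse.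
* `ramifiedCMRubinFormulaAtZp_iff_indexLawAtZp_holds` — with the three stubs PROVED: `S_open ↔ value law`
  at every `W`, `p`, no hypothesis; `rubinFormulaSevenZp_iff_valueSevenOfGZK` — route level on 𝒞₇:
  `(GZK → ∀ W ∈ 𝒞₇, S_open W 7) ↔ EllipticUnitValueSevenOfGZK`.

References: [BKNO] arXiv:2608.06879v1 §1.4, Thm. 7.2 (objects only); R. Miller, LMS J. Comput. Math. 14
(2011) Def. 1.1; cell files `Lines/rubin-formula-zp.md`, MEMO-k7r-c4-g6-CONTINUATION.md.
-/

noncomputable section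

open scoped Classical

open WeierstrassCurve NumberField IsDedekindDomain Field
  Literature.NumberTheory.EllipticCurves
  Literature.NumberTheory.EllipticCurves.Rank1Residual
  Literature.NumberTheory.EllipticCurves.BurungaleKobayashiNakamuraOta2026
  Summit.BirchSwinnertonDyer.Rank1Residual
  Summit.BirchSwinnertonDyer.Rank1Residual.X12
  Summit.BirchSwinnertonDyer.Rank1Residual.X12.O11

namespace Summit.BirchSwinnertonDyer.BirchSwinnertonDyer.Theorems.RamifiedSevenEllipticUnits

namespace RubinFormulaZpIffValue

section AnyPrime

variable {W : WeierstrassCurve ℚ} [W.IsElliptic] [W.IsGloballyMinimal] {p : ℕ} [Fact p.Prime]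

omit [W.IsGloballyMinimal] in
/-- **The converse seam of the reshaped line: (R-PR)|IMC-Zp ∧ S_dict′ ∧ S_sat-Zp ∧ S_B4′ ⟹ S_open.**
Given the pinned datum `D` with exponent `c` over `𝒪_𝔭 · z(𝟙)` and the IMC identity at an
analytic-rank-one frame: S_dict′ gives `m_loc = n + n'` and (inj), S_sat-Zp gives (sat), S_B4′ gives
`λ₀(D) = c + (n + n')`, the value law gives `c = n + n' + ord_p q + ord_p q'`; any local exponent `l` of
`D` equals `c + (n + n')` by uniqueness (`hasLocalBottomIndexExpZp_unique`), so
`l = 2(n + n') + ord_p q + ord_p q'`. [cite: BurungaleKobayashiNakamuraOta2026, §1.4 and Thm. 7.2 (arXiv:2608.06879 pp. 8, 41) (the objects; shape only)]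
[cite: Miller2011LMS, Def. 1.1 (arXiv:1010.2431 p. 3)] -/
theorem ramifiedCMRubinFormulaAtZp_of_indexLawAtZp (hlaw : RamifiedCMBottomClassIndexLawAtZp W p)
    (hdict : RamifiedCMLocalMordellWeilDictAtZp W p) (hsat : RamifiedCMBottomSaturationAtZp W p)
    (hsplit : RamifiedCMBottomLocalIndexSplitAtZp W p) : RamifiedCMRubinFormulaAtZp W p := by
  intro K _ _ 𝔭 W' _ _ C hF hr κ hκ γ _ P n P' n' hP hgen htors hdiv hndiv hP' hgen' htors' hdiv' hndiv'
    q q' hq hq' ι φ Ω 𝓔 D c hΩ hφ hc himc l hl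
  obtain ⟨hm, hinj⟩ :=
    hdict K 𝔭 W' C hF hr κ hκ P n P' n' hP hgen htors hdiv hndiv hP' hgen' htors' hdiv' hndiv'
  have hS := hsat K 𝔭 W' C hF hr κ hκ γ P n P' n' hP hgen htors hdiv hndiv hP' hgen' htors' hdiv' hndiv'
    q q' hq hq' ι φ Ω 𝓔 D c hΩ hφ hc himc (n + n') hm hinj
  have hl' : D.HasLocalBottomIndexExpZp (c + (n + n')) :=
    hsplit K 𝔭 W' C hF hr κ hκ γ ι φ Ω 𝓔 D c hc hS hinj (n + n') hm
  have hcl : l = c + (n + n') := D.hasLocalBottomIndexExpZp_unique hl hl'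
  have hval : (c : ℤ) = (n : ℤ) + n' + padicValRat p q + padicValRat p q' :=
    hlaw K 𝔭 W' C hF hr κ hκ γ P n P' n' hP hgen htors hdiv hndiv hP' hgen' htors' hdiv' hndiv'
      q q' hq hq' ι φ Ω 𝓔 D c hΩ hφ hc himc
  subst hcl
  push_cast
  linarith

omit [W.IsGloballyMinimal] in
/-- **`S_open ↔ (R-PR)|IMC-Zp` modulo S_dict′, S_sat-Zp, S_B4′** (the composition of the reshaped line,
`ramifiedCMBottomClassIndexLawAtZp_of_dictZp_of_satZp_of_splitZp_of_rubinFormulaZp`, p474028, and the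
converse seam above): the line `rubin-formula-zp` RESTATES the value child in the local exponent `λ₀`.
[cite: Miller2011LMS, Def. 1.1 (arXiv:1010.2431 p. 3)] -/
theorem ramifiedCMRubinFormulaAtZp_iff_indexLawAtZp (hdict : RamifiedCMLocalMordellWeilDictAtZp W p)
    (hsat : RamifiedCMBottomSaturationAtZp W p) (hsplit : RamifiedCMBottomLocalIndexSplitAtZp W p) :
    RamifiedCMRubinFormulaAtZp W p ↔ RamifiedCMBottomClassIndexLawAtZp W p :=
  ⟨ramifiedCMBottomClassIndexLawAtZp_of_dictZp_of_satZp_of_splitZp_of_rubinFormulaZp hdict hsat hsplit,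
    fun hlaw ↦ ramifiedCMRubinFormulaAtZp_of_indexLawAtZp hlaw hdict hsat hsplit⟩

/-- **`S_open ↔ (R-PR)|IMC-Zp` with NO hypothesis** at every globally minimal `W` and prime `p`: S_dict′
(k7r-c3, p474339), S_B4′ (p474196) and S_sat-Zp (`BottomSaturationUncond.ramifiedCMBottomSaturationAtZp_holds`,
p479978) are theorems.
[cite: Miller2011LMS, Def. 1.1 (arXiv:1010.2431 p. 3)] [cite: PerrinRiou1987BSMF, §0 pp. 401–402] -/
theorem ramifiedCMRubinFormulaAtZp_iff_indexLawAtZp_holds :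
    RamifiedCMRubinFormulaAtZp W p ↔ RamifiedCMBottomClassIndexLawAtZp W p :=
  ramifiedCMRubinFormulaAtZp_iff_indexLawAtZp (ramifiedCMLocalMordellWeilDictAtZp_holds W p)
    (BottomSaturationUncond.ramifiedCMBottomSaturationAtZp_holds W p)
    (ramifiedCMBottomLocalIndexSplitAtZp_holds W p)

end AnyPrime

section ClassCSeven

/-- **Route level, 𝒞₇ at `p = 7`: the registered research stub's statement (`stub_rubinFormulaSevenZp`)
placed under the crux's GZK antecedent is EQUIVALENT to the route item `EllipticUnitValueSevenOfGZK`
(stmt-BirchSwinnertonDyer-19945).** Pointwise in `W` by `ramifiedCMRubinFormulaAtZp_iff_indexLawAtZp_holds`;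
the GZK antecedent is threaded through unchanged. The line `rubin-formula-zp` is thus, in the kernel, a
RESTATEMENT of the crux in the local exponent `λ₀` with all dictionary stubs discharged.
[cite: Miller2011LMS, Def. 1.1 (arXiv:1010.2431 p. 3)] -/
theorem rubinFormulaSevenZp_iff_valueSevenOfGZK :
    (Literature.NumberTheory.EllipticCurves.rank_eq_analyticRank_of_analyticRank_le_one →
      ∀ (W : WeierstrassCurve ℚ) [W.IsElliptic] [W.IsGloballyMinimal] [Fact (Nat.Prime 7)],
        X12.ClassCSeven W → RamifiedCMRubinFormulaAtZp W 7) ↔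
    Summit.BirchSwinnertonDyer.BirchSwinnertonDyer.Theses.RamifiedSevenEllipticUnits.EllipticUnitValueSevenOfGZK :=
  ⟨fun h hGZK W _ _ _ hW ↦ ramifiedCMRubinFormulaAtZp_iff_indexLawAtZp_holds.1 (h hGZK W hW),
    fun h hGZK W _ _ _ hW ↦ ramifiedCMRubinFormulaAtZp_iff_indexLawAtZp_holds.2 (h hGZK W hW)⟩

/-- **On 𝒞₇ the research stub IMPLIES the crux** (the direction a proof of S_open would use; the
skeleton's composition with S_dict′, S_sat-Zp, S_B4′ discharged). [cite: Miller2011LMS, Def. 1.1 (arXiv:1010.2431 p. 3)] -/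
theorem valueSevenOfGZK_of_rubinFormulaSevenZp
    (h : ∀ (W : WeierstrassCurve ℚ) [W.IsElliptic] [W.IsGloballyMinimal] [Fact (Nat.Prime 7)],
      X12.ClassCSeven W → RamifiedCMRubinFormulaAtZp W 7) :
    Summit.BirchSwinnertonDyer.BirchSwinnertonDyer.Theses.RamifiedSevenEllipticUnits.EllipticUnitValueSevenOfGZK :=
  fun _ W _ _ _ hW ↦ ramifiedCMRubinFormulaAtZp_iff_indexLawAtZp_holds.1 (h W hW)

end ClassCSeven

/-! ### §3 (append, seat `bsd-cm-k7r-c4` g7, 2026-08-27). Skeleton v3 — the RELATIVE-VALUATION re-cut of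
S_open (`X12/O11/RamifiedRelativeValuationLineZp.lean`, p487655; planner D123 (b)/D127): on 𝒞₇ the two
registered v3 stubs S_relval and S_arch (base member `D₀ = −11`) give S_open, hence the crux. -/

section RelativeValuationV3

/-- **S_relval ∧ S_arch on 𝒞₇ ⟹ S_open on 𝒞₇** — the exact shape of the registered stubs
`stub_relativeValuationSevenZp` / `stub_archimedeanValuationSevenZp` of skeleton v3 feeding the fit witness
`stub_rubinFormulaSevenZp` (by `X12.O11.ramifiedCMRubinFormulaAtZp_of_relativeValuation_of_archimedean`).
[cite: BurungaleKobayashiNakamuraOta2026, §1.4 (arXiv:2608.06879 p. 8) (the deferred value formula; shape only)] -/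
theorem rubinFormulaSevenZp_of_relval_of_arch
    (hrel : ∀ (W : WeierstrassCurve ℚ) [W.IsElliptic] [W.IsGloballyMinimal] [Fact (Nat.Prime 7)],
      X12.ClassCSeven W → RamifiedCMRelativeValuationAtZp W 7 (-11))
    (harch : ∀ (W : WeierstrassCurve ℚ) [W.IsElliptic] [W.IsGloballyMinimal] [Fact (Nat.Prime 7)],
      X12.ClassCSeven W → RamifiedCMArchimedeanValuationAtZp W 7 (-11)) :
    ∀ (W : WeierstrassCurve ℚ) [W.IsElliptic] [W.IsGloballyMinimal] [Fact (Nat.Prime 7)],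
      X12.ClassCSeven W → RamifiedCMRubinFormulaAtZp W 7 :=
  fun W _ _ _ hW ↦ ramifiedCMRubinFormulaAtZp_of_relativeValuation_of_archimedean (hrel W hW) (harch W hW)

/-- **S_relval ∧ S_arch on 𝒞₇ ⟹ the crux `EllipticUnitValueSevenOfGZK`** (v3's two open stubs close the
value crux in the kernel, the three dictionary stubs S_dict′/S_sat-Zp/S_B4′ being landed): composition of
`rubinFormulaSevenZp_of_relval_of_arch` with `valueSevenOfGZK_of_rubinFormulaSevenZp`. The GZK antecedent of the
crux stays idle here exactly as in §2 (S_sat-Zp closed unconditionally, p479978).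
[cite: Miller2011LMS, Def. 1.1 (arXiv:1010.2431 p. 3)] -/
theorem valueSevenOfGZK_of_relval_of_arch
    (hrel : ∀ (W : WeierstrassCurve ℚ) [W.IsElliptic] [W.IsGloballyMinimal] [Fact (Nat.Prime 7)],
      X12.ClassCSeven W → RamifiedCMRelativeValuationAtZp W 7 (-11))
    (harch : ∀ (W : WeierstrassCurve ℚ) [W.IsElliptic] [W.IsGloballyMinimal] [Fact (Nat.Prime 7)],
      X12.ClassCSeven W → RamifiedCMArchimedeanValuationAtZp W 7 (-11)) :
    Summit.BirchSwinnertonDyer.BirchSwinnertonDyer.Theses.RamifiedSevenEllipticUnits.EllipticUnitValueSevenOfGZK :=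
  valueSevenOfGZK_of_rubinFormulaSevenZp (rubinFormulaSevenZp_of_relval_of_arch hrel harch)

end RelativeValuationV3

end RubinFormulaZpIffValue

end Summit.BirchSwinnertonDyer.BirchSwinnertonDyer.Theorems.RamifiedSevenEllipticUnits

end
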